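import Literature.Computation.Certificates.SemidefiniteRigorousBoundsEnclosure
import Literature.Computation.Certificates.DyadicEigCertificate
import Literature.Computation.Certificates.FactoredCertificate

/-!
# The LMI-form rigorous bound with FREE (unbounded) variables: exact residuals on the free coordinates

Topic `Literature/Computation/Certificates`; sibling of `SemidefiniteRigorousBounds.lean`
(`JanssonChaykinKeil.lmiForm_bound`), `SemidefiniteRigorousBoundsEnclosure.lean`
(`lmiForm_bound_traceBoundOn`), `DyadicEigCertificate.lean` and `FactoredCertificate.lean`.

Those files state the inequality-form ("y-", LMI-form) rigorous lower bound of
Jansson–Chaykin–Keil with an a-priori bound `|y_v| ≤ ρ_v` on EVERY variable `v ≠ u`; their docstrings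
record as NOT COVERED the case of unbounded variables («`ρ_v` finite for all `v ≠ u`; certsdp's
`absorb_unbounded` must have made their residuals vanish — not expressed here»). The problem format
`certsdp-problem/1` allows `ρ_v = null` (no a-priori bound), and the readers' rule (certsdp
`RIGOR-LAYER.md` §2 «Unbounded variables must end with `r_v = 0`»; reader A's check
`unbounded_residual_zero`) is the semidefinite analogue of the free-variable clause of the rigorous
LP bound of Jansson / Keil–Jansson: for the indices `j ∈ J^∞` whose simple bounds are both infinite
the dual equations must hold EXACTLY, while the finitely bounded indices are charged their signed
defect times the bound [KeilJansson2006, Thm 2 (ii)–(iii) and (4)].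

This file types that rule, as COROLLARIES of `lmiForm_bound` (instantiate the missing bound by
`|y_v|` itself — the charge `|r_v|·|y_v|` vanishes because `r_v = 0`):

* `JanssonChaykinKeil.lmiForm_bound_freeVars` — a-priori bounds as `ρ : V → Option ℝ` (the layout of
  `certsdp-problem/1` `bounds`: `none` = unbounded); hypotheses `|y_v| ≤ b` when `ρ_v = some b` and
  `r_v = 0` when `ρ_v = none`; conclusion
  `β − Σ_{v ≠ u} |r_v|·(ρ_v).getD 0 − Σ_k |min(0,d_k)| τ_k ≤ c·y + c₀`.
* `JanssonChaykinKeil.lmiForm_bound_freeVars_traceBoundOn` — the same with trace bounds used only on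
  a set `B` of blocks (`d_k ≥ 0` off `B`): this is the COMPLETE bound formula a reader of a
  `certsdp-conic/1` certificate evaluates (free variables, boxed variables, Gram blocks, shifted blocks).
* `JanssonChaykinKeil.lmiForm_bound_of_residual_eq_zero` — every variable free: plain weak duality with
  eigenvalue-defect terms, `β − Σ_k |min(0,d_k)| τ_k ≤ c·y + c₀`.
* `DyadicEigCertificate.bound_freeVars`, `FactoredCertificate.bound_freeVars` — the two certificate
  layouts (Cholesky-residual-witnessed blocks; Gram-factor blocks) with free variables.

Recorded as COROLLARIES (composition / specialisation of results already in the tree), not as printed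
statements of either source:
* C. Jansson, D. Chaykin, C. Keil, SIAM J. Numer. Anal. 46 (2007/08) 180–200 [JanssonChaykinKeil2008],
  Lemma 3.1 and the mechanism of Thm 3.2 — through `JanssonChaykinKeil.lmiForm_bound`;
* C. Keil, C. Jansson, Reliable Computing 12 (2006) 303–321 [KeilJansson2006], Theorem 2: conditions
  (ii) (exact equations on `J^∞`) and (iii)/(4) (signed defects times finite simple bounds) — the
  printed free-variable rule, there for linear programs (restating Jansson, SIAM J. Optim. 14 (2004)).

No definitions, no named facts, no instances; five short proofs.
-/

namespace Literature.Computation.Certificates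

open Matrix Finset
open scoped BigOperators

namespace JanssonChaykinKeil

section FreeVariables

variable {V : Type*} [Fintype V] [DecidableEq V] {E : Type*} [Fintype E] {I : Type*} [Fintype I]
variable {K : Type*} [Fintype K] {σ : K → Type*} [∀ k, Fintype (σ k)] [∀ k, DecidableEq (σ k)]

/-- theorem (**rigorous lower bound in LMI form with free variables**). Data: objective `c·y + c₀`
over `y ∈ ℝ^V`, unit variable `y_u = 1`, a-priori bounds `ρ : V → Option ℝ` — `|y_v| ≤ b` when
`ρ_v = some b`, NO bound when `ρ_v = none` (`v ≠ u`) — equality rows `row_e·y = rhs_e`, inequality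
rows `row_i·y ≤ upper_i`, PSD blocks `M_k(y) = C_k + Σ_v y_v F_{k,v} ⪰ 0` with trace bounds
`tr M_k(y) ≤ τ_k`. Certificate: `λ_e` free, `κ_i ≥ 0`, blocks `Z_k` with `Z_k − d_k·1 ⪰ 0`, exact
residuals `r_v = c_v − Σ_e λ_e row_e[v] + Σ_i κ_i row_i[v] − Σ_k tr(Z_k F_{k,v})` and
`β = c₀ + r_u + Σ_e λ_e rhs_e − Σ_i κ_i upper_i − Σ_k tr(Z_k C_k)`, and THE FREE-VARIABLE RULE:
`r_v = 0` whenever `ρ_v = none` (`v ≠ u`). Then every feasible `y` satisfies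
`β − Σ_{v ≠ u} |r_v|·(ρ_v).getD 0 − Σ_k |min(0, d_k)| τ_k ≤ c·y + c₀` (the unbounded variables
contribute nothing to the charge). (Proof: `lmiForm_bound` with the bound `|y_v|` itself on the
free coordinates; their charge `|r_v|·|y_v|` is `0`.) SOURCE:
[cite: JanssonChaykinKeil2008, Lemma 3.1 and Thm 3.2 (inequality-form corollary)] and
[cite: KeilJansson2006, Thm 2 (ii)–(iii) and (4) (free variables: exact equations; finite bounds: defect charge)]
— a COROLLARY; DEVIATIONS from print: LMI form with PSD blocks instead of the printed LP, symmetric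
bounds `|y_v| ≤ ρ_v` instead of two-sided simple bounds. CERTIFICATE KIND: certsdp-conic/1 against
certsdp-problem/1 with `bounds.abs[v] = null` allowed; FIELDS: `ρ v = none ↦ null bound`,
`hr0 ↦ reader A check unbounded_residual_zero`, others as in `lmiForm_bound`. NOT COVERED: how the
producer achieves `r_v = 0` (certsdp `absorb_unbounded` / `absorb_sign_rows`); the readers' parsing. -/
theorem lmiForm_bound_freeVars (c : V → ℝ) (c0 : ℝ) (u : V)
    (rowE : E → V → ℝ) (rhs : E → ℝ) (rowI : I → V → ℝ) (upper : I → ℝ)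
    (Cb : ∀ k, Matrix (σ k) (σ k) ℝ) (F : ∀ k, V → Matrix (σ k) (σ k) ℝ)
    (ρ : V → Option ℝ) (τ : K → ℝ)
    -- a feasible point
    {y : V → ℝ} (hyu : y u = 1) (hρ : ∀ v, v ≠ u → ∀ b, ρ v = some b → |y v| ≤ b)
    (heq : ∀ e, ∑ v, rowE e v * y v = rhs e) (hineq : ∀ i, ∑ v, rowI i v * y v ≤ upper i)
    (hpsd : ∀ k, (Cb k + ∑ v, y v • F k v).PosSemidef)
    (hτ : ∀ k, trace (Cb k + ∑ v, y v • F k v) ≤ τ k)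
    -- the certificate
    (lam : E → ℝ) (κ : I → ℝ) (hκ : ∀ i, 0 ≤ κ i) (Z : ∀ k, Matrix (σ k) (σ k) ℝ) (dZ : K → ℝ)
    (hZ : ∀ k, (Z k - dZ k • (1 : Matrix (σ k) (σ k) ℝ)).PosSemidef)
    (r : V → ℝ)
    (hr : ∀ v, r v = c v - ∑ e, lam e * rowE e v + ∑ i, κ i * rowI i v - ∑ k, trace (Z k * F k v))
    -- the free-variable rule: exact residual on every unbounded coordinate
    (hr0 : ∀ v, v ≠ u → ρ v = none → r v = 0)
    (β : ℝ)
    (hβ : β = c0 + r u + ∑ e, lam e * rhs e - ∑ i, κ i * upper i - ∑ k, trace (Z k * Cb k)) :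
    β - ∑ v ∈ Finset.univ.erase u, |r v| * (ρ v).getD 0 - ∑ k, |min 0 (dZ k)| * τ k ≤
      ∑ v, c v * y v + c0 := by
  -- instantiate the missing bounds by |y v| itself
  have hρ' : ∀ v, v ≠ u → |y v| ≤ (ρ v).getD |y v| := by
    intro v hv
    cases h : ρ v with
    | none => simp
    | some b => simpa using hρ v hv b h
  have h := lmiForm_bound c c0 u rowE rhs rowI upper Cb F (fun v => (ρ v).getD |y v|) τ hyu hρ'
    heq hineq hpsd hτ lam κ hκ Z dZ hZ r hr β hβ
  have hsum : ∑ v ∈ Finset.univ.erase u, |r v| * (ρ v).getD |y v| =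
      ∑ v ∈ Finset.univ.erase u, |r v| * (ρ v).getD 0 := by
    refine Finset.sum_congr rfl fun v hv => ?_
    have hvu : v ≠ u := Finset.ne_of_mem_erase hv
    cases h : ρ v with
    | none => rw [hr0 v hvu h]; simp
    | some b => simp
  rw [hsum] at h
  exact h

/-- theorem (**the complete reader formula**: free variables AND trace bounds only where needed).
As `lmiForm_bound_freeVars`, but trace bounds `tr M_k(y) ≤ τ_k` are assumed only on a set `B` of
blocks and the certificate's eigen-shift is nonnegative off `B` (`d_k ≥ 0`, e.g. Gram blocks or
blocks certified PSD): every feasible `y` satisfies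
`β − Σ_{v ≠ u} |r_v|·(ρ_v).getD 0 − Σ_{k ∈ B} |min(0, d_k)| τ_k ≤ c·y + c₀` — the number a reader of a
certsdp-conic/1 certificate recomputes (certsdp `RIGOR-LAYER.md` §2: residual charge over the bounded
variables, exact residual on the unbounded ones, trace-bound penalty only for blocks with `d_k < 0`).
SOURCE: [cite: JanssonChaykinKeil2008, Thm 3.2 (3.5)–(3.6): bounds only on the set B; inequality-form corollary)]
and [cite: KeilJansson2006, Thm 2 (ii)–(iii) and (4)] — a COROLLARY of
`lmiForm_bound_traceBoundOn`; DEVIATIONS / KIND / FIELDS: as in `lmiForm_bound_freeVars` and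
`lmiForm_bound_traceBoundOn` (`B ↦ blocks carrying a trace_bound that the certificate consumes`).
NOT COVERED: as there. -/
theorem lmiForm_bound_freeVars_traceBoundOn (c : V → ℝ) (c0 : ℝ) (u : V)
    (rowE : E → V → ℝ) (rhs : E → ℝ) (rowI : I → V → ℝ) (upper : I → ℝ)
    (Cb : ∀ k, Matrix (σ k) (σ k) ℝ) (F : ∀ k, V → Matrix (σ k) (σ k) ℝ) (ρ : V → Option ℝ)
    -- a feasible point
    {y : V → ℝ} (hyu : y u = 1) (hρ : ∀ v, v ≠ u → ∀ b, ρ v = some b → |y v| ≤ b)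
    (heq : ∀ e, ∑ v, rowE e v * y v = rhs e) (hineq : ∀ i, ∑ v, rowI i v * y v ≤ upper i)
    (hpsd : ∀ k, (Cb k + ∑ v, y v • F k v).PosSemidef)
    -- trace bounds on the blocks of `B` only
    (B : Finset K) (τ : K → ℝ) (hτ : ∀ k ∈ B, trace (Cb k + ∑ v, y v • F k v) ≤ τ k)
    -- the certificate, with nonnegative eigen-shift off `B`
    (lam : E → ℝ) (κ : I → ℝ) (hκ : ∀ i, 0 ≤ κ i) (Z : ∀ k, Matrix (σ k) (σ k) ℝ) (dZ : K → ℝ)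
    (hZ : ∀ k, (Z k - dZ k • (1 : Matrix (σ k) (σ k) ℝ)).PosSemidef) (hd : ∀ k ∉ B, 0 ≤ dZ k)
    (r : V → ℝ)
    (hr : ∀ v, r v = c v - ∑ e, lam e * rowE e v + ∑ i, κ i * rowI i v - ∑ k, trace (Z k * F k v))
    (hr0 : ∀ v, v ≠ u → ρ v = none → r v = 0)
    (β : ℝ)
    (hβ : β = c0 + r u + ∑ e, lam e * rhs e - ∑ i, κ i * upper i - ∑ k, trace (Z k * Cb k)) :
    β - ∑ v ∈ Finset.univ.erase u, |r v| * (ρ v).getD 0 - ∑ k ∈ B, |min 0 (dZ k)| * τ k ≤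
      ∑ v, c v * y v + c0 := by
  have hρ' : ∀ v, v ≠ u → |y v| ≤ (ρ v).getD |y v| := by
    intro v hv
    cases h : ρ v with
    | none => simp
    | some b => simpa using hρ v hv b h
  have h := lmiForm_bound_traceBoundOn c c0 u rowE rhs rowI upper Cb F (fun v => (ρ v).getD |y v|)
    hyu hρ' heq hineq hpsd B τ hτ lam κ hκ Z dZ hZ hd r hr β hβ
  have hsum : ∑ v ∈ Finset.univ.erase u, |r v| * (ρ v).getD |y v| =
      ∑ v ∈ Finset.univ.erase u, |r v| * (ρ v).getD 0 := by
    refine Finset.sum_congr rfl fun v hv => ?_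
    have hvu : v ≠ u := Finset.ne_of_mem_erase hv
    cases h : ρ v with
    | none => rw [hr0 v hvu h]; simp
    | some b => simp
  rw [hsum] at h
  exact h

/-- theorem (**every variable free: plain weak duality with eigenvalue-defect terms**). If the
residuals vanish off the unit variable, `r_v = 0 (v ≠ u)`, then every feasible `y` satisfies
`β − Σ_k |min(0, d_k)| τ_k ≤ c·y + c₀` — no a-priori box at all (the route of a certificate whose
PSD multipliers are the EXACT slacks of a strictly / exactly dual-feasible point, as in VSDP's
`vsdplow`). SOURCE: [cite: JanssonChaykinKeil2008, Thm 3.2 with B = ∅ on the variable side (inequality-form corollary; weak duality)]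
and [cite: KeilJansson2006, Thm 2 (ii) (all indices in J^∞)] — a COROLLARY of
`lmiForm_bound_freeVars` with `ρ ≡ none`; DEVIATIONS / KIND: as there (certsdp-problem/1 with
`default_abs = null` and no per-variable bounds). NOT COVERED: as there. -/
theorem lmiForm_bound_of_residual_eq_zero (c : V → ℝ) (c0 : ℝ) (u : V)
    (rowE : E → V → ℝ) (rhs : E → ℝ) (rowI : I → V → ℝ) (upper : I → ℝ)
    (Cb : ∀ k, Matrix (σ k) (σ k) ℝ) (F : ∀ k, V → Matrix (σ k) (σ k) ℝ) (τ : K → ℝ)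
    -- a feasible point (no a-priori box)
    {y : V → ℝ} (hyu : y u = 1)
    (heq : ∀ e, ∑ v, rowE e v * y v = rhs e) (hineq : ∀ i, ∑ v, rowI i v * y v ≤ upper i)
    (hpsd : ∀ k, (Cb k + ∑ v, y v • F k v).PosSemidef)
    (hτ : ∀ k, trace (Cb k + ∑ v, y v • F k v) ≤ τ k)
    -- the certificate
    (lam : E → ℝ) (κ : I → ℝ) (hκ : ∀ i, 0 ≤ κ i) (Z : ∀ k, Matrix (σ k) (σ k) ℝ) (dZ : K → ℝ)
    (hZ : ∀ k, (Z k - dZ k • (1 : Matrix (σ k) (σ k) ℝ)).PosSemidef)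
    (r : V → ℝ)
    (hr : ∀ v, r v = c v - ∑ e, lam e * rowE e v + ∑ i, κ i * rowI i v - ∑ k, trace (Z k * F k v))
    (hr0 : ∀ v, v ≠ u → r v = 0)
    (β : ℝ)
    (hβ : β = c0 + r u + ∑ e, lam e * rhs e - ∑ i, κ i * upper i - ∑ k, trace (Z k * Cb k)) :
    β - ∑ k, |min 0 (dZ k)| * τ k ≤ ∑ v, c v * y v + c0 := by
  have h := lmiForm_bound_freeVars c c0 u rowE rhs rowI upper Cb F (fun _ => (none : Option ℝ)) τ hyu
    (fun v _ b hb => absurd hb (by simp)) heq hineq hpsd hτ lam κ hκ Z dZ hZ r hr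
    (fun v hv _ => hr0 v hv) β hβ
  simpa using h

end FreeVariables

end JanssonChaykinKeil

namespace DyadicEigCertificate

variable {V : Type*} [Fintype V] [DecidableEq V] {E : Type*} [Fintype E] {I : Type*} [Fintype I]
variable {K : Type*} [Fintype K] {σ : K → Type*} [∀ k, Fintype (σ k)] [∀ k, DecidableEq (σ k)]
variable {π : K → Type*} [∀ k, Fintype (π k)]

/-- theorem (**conic/1 "dyadic-eig" certificate with free variables**). As `DyadicEigCertificate.bound`
(PSD multipliers `Z_k` with Cholesky-residual witnesses `(R_k, d_k, t_k, σ_k, r_k)`), but with the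
a-priori bounds in the `Option` layout of certsdp-problem/1 and the free-variable rule `r_v = 0`
whenever `ρ_v = none`: every feasible `y` satisfies
`β − Σ_{v≠u} |r_v|·(ρ_v).getD 0 − Σ_k |min(0, (t_k σ_k − r_k)/(t_k² d_k))| τ_k ≤ c·y + c₀`.
SOURCE: [cite: JanssonChaykinKeil2008, Lemma 3.1 and Thm 3.2 (inequality-form corollary)],
[cite: KeilJansson2006, Thm 2 (ii)–(iii) and (4)],
[cite: Rump1999VerifiedLargeSystems, §4 eq. after (12) and Algorithm 4.1 step 7 (PDF p. 243)] —
a COROLLARY composing `JanssonChaykinKeil.lmiForm_bound_freeVars` with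
`DyadicCholResidualWitness.posSemidef_sub_smul_one`; DEVIATIONS from print: not a printed statement.
CERTIFICATE KIND: certsdp-conic/1 `dyadic-eig` (Gram blocks = case `σ_k = 0`, `R_k = F_kᵀ`, `r_k = 0`)
against certsdp-problem/1 with null bounds allowed; FIELDS: as in `bound`, plus
`ρ v = none ↦ bounds.abs null`, `hr0 ↦ reader A check unbounded_residual_zero`. This DISCHARGES the
«unbounded variables — not expressed here» clause of `bound`'s NOT COVERED list. NOT COVERED: the
float solver / float Cholesky; the readers' parsing; how the producer reaches `r_v = 0`. -/
theorem bound_freeVars (c : V → ℝ) (c0 : ℝ) (u : V)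
    (rowE : E → V → ℝ) (rhs : E → ℝ) (rowI : I → V → ℝ) (upper : I → ℝ)
    (Cb : ∀ k, Matrix (σ k) (σ k) ℝ) (F : ∀ k, V → Matrix (σ k) (σ k) ℝ)
    (ρ : V → Option ℝ) (τ : K → ℝ)
    -- a feasible point
    {y : V → ℝ} (hyu : y u = 1) (hρ : ∀ v, v ≠ u → ∀ b, ρ v = some b → |y v| ≤ b)
    (heq : ∀ e, ∑ v, rowE e v * y v = rhs e) (hineq : ∀ i, ∑ v, rowI i v * y v ≤ upper i)
    (hpsd : ∀ k, (Cb k + ∑ v, y v • F k v).PosSemidef)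
    (hτ : ∀ k, trace (Cb k + ∑ v, y v • F k v) ≤ τ k)
    -- the certificate: multipliers and symmetric PSD-candidate blocks
    (lam : E → ℝ) (κ : I → ℝ) (hκ : ∀ i, 0 ≤ κ i) (Z : ∀ k, Matrix (σ k) (σ k) ℝ)
    (hZh : ∀ k, (Z k).IsHermitian)
    -- the Cholesky-residual witnesses of the blocks
    (Rw : ∀ k, Matrix (π k) (σ k) ℝ) (dd tt sg rr : K → ℝ) (hdd : ∀ k, 0 < dd k)
    (htt : ∀ k, 0 < tt k)
    (hrow : ∀ k i,
      ∑ j, ‖DyadicCholResidualWitness.residual (Z k) (Rw k) (dd k) (tt k) (sg k) i j‖ ≤ rr k)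
    -- the exact residuals and the free-variable rule
    (r : V → ℝ)
    (hr : ∀ v, r v = c v - ∑ e, lam e * rowE e v + ∑ i, κ i * rowI i v - ∑ k, trace (Z k * F k v))
    (hr0 : ∀ v, v ≠ u → ρ v = none → r v = 0)
    (β : ℝ)
    (hβ : β = c0 + r u + ∑ e, lam e * rhs e - ∑ i, κ i * upper i - ∑ k, trace (Z k * Cb k)) :
    β - ∑ v ∈ Finset.univ.erase u, |r v| * (ρ v).getD 0
      - ∑ k, |min 0 ((tt k * sg k - rr k) / (tt k ^ 2 * dd k))| * τ k ≤ ∑ v, c v * y v + c0 := by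
  have hZ : ∀ k, (Z k - ((tt k * sg k - rr k) / (tt k ^ 2 * dd k)) •
      (1 : Matrix (σ k) (σ k) ℝ)).PosSemidef := fun k => by
    simpa only [RCLike.ofReal_real_eq_id, id_eq] using
      DyadicCholResidualWitness.posSemidef_sub_smul_one (hZh k) (Rw k) (hdd k) (htt k) (hrow k)
  exact JanssonChaykinKeil.lmiForm_bound_freeVars c c0 u rowE rhs rowI upper Cb F ρ τ hyu hρ heq hineq
    hpsd hτ lam κ hκ Z (fun k => (tt k * sg k - rr k) / (tt k ^ 2 * dd k)) hZ r hr hr0 β hβ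

end DyadicEigCertificate

namespace FactoredCertificate

variable {V : Type*} [Fintype V] [DecidableEq V] {E : Type*} [Fintype E] {I : Type*} [Fintype I]
variable {K : Type*} [Fintype K] {σ : K → Type*} [∀ k, Fintype (σ k)] [∀ k, DecidableEq (σ k)]
variable {π : K → Type*} [∀ k, Fintype (π k)]

/-- theorem (**Gram-mode certificate with free variables**). As `FactoredCertificate.bound` (PSD
multipliers given as factors, `Z_k = W_k W_kᵀ`, no eigenvalue terms, no trace bounds), with the
a-priori bounds in the `Option` layout of certsdp-problem/1 and the free-variable rule `r_v = 0`
whenever `ρ_v = none`: every feasible `y` satisfies `β − Σ_{v≠u} |r_v|·(ρ_v).getD 0 ≤ c·y + c₀`.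
SOURCE: [cite: JanssonChaykinKeil2008, Lemma 3.1 and Thm 3.2 (inequality-form corollary)],
[cite: KeilJansson2006, Thm 2 (ii)–(iii) and (4)],
[cite: BurerMonteiro2003, §1 eq. (2) (X = R Rᵀ is PSD by construction)] — a COROLLARY of
`JanssonChaykinKeil.lmiForm_bound_freeVars` with `Z_k = W_k W_kᵀ`, `d_k = 0`; DEVIATIONS from print:
not a printed statement. CERTIFICATE KIND: certsdp-conic/1 `gram` / certsdp-cert/0 against a problem
with null bounds allowed (e.g. the free coordinates of a reduced moment program); FIELDS: as in
`bound`, plus `ρ v = none ↦ null bound`, `hr0 ↦ unbounded_residual_zero`. The all-free case is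
`FactoredCertificate.bound_of_residual_eq_zero`. NOT COVERED: as in `bound`. -/
theorem bound_freeVars (c : V → ℝ) (c0 : ℝ) (u : V)
    (rowE : E → V → ℝ) (rhs : E → ℝ) (rowI : I → V → ℝ) (upper : I → ℝ)
    (Cb : ∀ k, Matrix (σ k) (σ k) ℝ) (F : ∀ k, V → Matrix (σ k) (σ k) ℝ) (ρ : V → Option ℝ)
    -- a feasible point
    {y : V → ℝ} (hyu : y u = 1) (hρ : ∀ v, v ≠ u → ∀ b, ρ v = some b → |y v| ≤ b)
    (heq : ∀ e, ∑ v, rowE e v * y v = rhs e) (hineq : ∀ i, ∑ v, rowI i v * y v ≤ upper i)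
    (hpsd : ∀ k, (Cb k + ∑ v, y v • F k v).PosSemidef)
    -- the factored certificate
    (lam : E → ℝ) (κ : I → ℝ) (hκ : ∀ i, 0 ≤ κ i) (W : ∀ k, Matrix (σ k) (π k) ℝ)
    (r : V → ℝ)
    (hr : ∀ v, r v = c v - ∑ e, lam e * rowE e v + ∑ i, κ i * rowI i v
      - ∑ k, trace (W k * (W k)ᵀ * F k v))
    (hr0 : ∀ v, v ≠ u → ρ v = none → r v = 0)
    (β : ℝ)
    (hβ : β = c0 + r u + ∑ e, lam e * rhs e - ∑ i, κ i * upper i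
      - ∑ k, trace (W k * (W k)ᵀ * Cb k)) :
    β - ∑ v ∈ Finset.univ.erase u, |r v| * (ρ v).getD 0 ≤ ∑ v, c v * y v + c0 := by
  have hZ : ∀ k, (W k * (W k)ᵀ - (0 : ℝ) • (1 : Matrix (σ k) (σ k) ℝ)).PosSemidef := by
    intro k
    rw [zero_smul, sub_zero]
    simpa only [conjTranspose_eq_transpose_of_trivial] using posSemidef_self_mul_conjTranspose (W k)
  have h := JanssonChaykinKeil.lmiForm_bound_freeVars c c0 u rowE rhs rowI upper Cb F ρ
    (fun k => trace (Cb k + ∑ v, y v • F k v)) hyu hρ heq hineq hpsd (fun k => le_rfl)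
    lam κ hκ (fun k => W k * (W k)ᵀ) (fun _ => 0) hZ r hr hr0 β hβ
  simpa only [min_self, abs_zero, zero_mul, Finset.sum_const_zero, sub_zero] using h

end FactoredCertificate

/-! ### Appendix (2026-08-27): the UPPER side in the same `Option` layout

The upper bound from an exactly feasible point (`JanssonChaykinKeil.lmiForm_sInf_le_of_feasible`)
needs no free-variable rule — feasibility of the point is the whole hypothesis — but its feasible SET is
written with a bound `|y_v| ≤ ρ_v` on every `v ≠ u`. For a program whose `certsdp-problem/1` file has
`null` bounds the literal feasible set constrains only the bounded coordinates; the statement below is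
that literal form (same one-line proof), so that both sides of a two-sided enclosure of such a program
cite decls with the same `ρ : V → Option ℝ` data. -/

namespace JanssonChaykinKeil

section FreeVariablesUpper

variable {V : Type*} [Fintype V] [DecidableEq V] {E : Type*} [Fintype E] {I : Type*} [Fintype I]
variable {K : Type*} [Fintype K] {σ : K → Type*} [∀ k, Fintype (σ k)] [∀ k, DecidableEq (σ k)]

omit [DecidableEq V] [Fintype E] [Fintype I] [Fintype K] [∀ k, Fintype (σ k)] [∀ k, DecidableEq (σ k)] in
/-- theorem (**upper bound of the optimal value from an exactly feasible point; free-variable layout**).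
Inequality-form program with a-priori bounds `ρ : V → Option ℝ` (`none` = no bound): any EXACTLY
feasible `ỹ` (unit variable, `|ỹ_v| ≤ b` whenever `ρ_v = some b`, exact rows, `M_k(ỹ) ⪰ 0`) bounds the
infimum of `c·y + c₀` over the (so boxed) feasible set from above, `inf ≤ c·ỹ + c₀`, provided that set of
values is bounded below (e.g. by `lmiForm_bound_freeVars`). SOURCE: [cite: JanssonChaykinKeil2008, Thm 4.1]
(inequality-form analogue, exact point) and [cite: KeilJansson2006, Thm 1 (a feasible point of the stated box bounds the optimal value)]
— a COROLLARY (`csInf_le`), the `Option`-layout twin of `lmiForm_sInf_le_of_feasible`; DEVIATIONS from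
print: LMI form, exactly feasible point (no enclosure), symmetric bounds present only where `ρ_v = some _`.
CERTIFICATE KIND: certsdp-primal/1 against a certsdp-problem/1 with `null` bounds allowed; FIELDS:
`yt ↦ the exact point`, `ρ v = none ↦ bounds.abs null` (readers A/B check `|yt_v| ≤ ρ_v` only where a
bound is stated). NOT COVERED: how `M_k(ỹ) ⪰ 0` is certified (the primal/1 witnesses); approximately
feasible points. -/
theorem lmiForm_sInf_le_of_feasible_freeVars (c : V → ℝ) (c0 : ℝ) (u : V)
    (rowE : E → V → ℝ) (rhs : E → ℝ) (rowI : I → V → ℝ) (upper : I → ℝ)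
    (Cb : ∀ k, Matrix (σ k) (σ k) ℝ) (F : ∀ k, V → Matrix (σ k) (σ k) ℝ) (ρ : V → Option ℝ)
    {yt : V → ℝ} (hyu : yt u = 1) (hρ : ∀ v, v ≠ u → ∀ b, ρ v = some b → |yt v| ≤ b)
    (heq : ∀ e, ∑ v, rowE e v * yt v = rhs e) (hineq : ∀ i, ∑ v, rowI i v * yt v ≤ upper i)
    (hpsd : ∀ k, (Cb k + ∑ v, yt v • F k v).PosSemidef)
    (hbdd : BddBelow {val : ℝ | ∃ y : V → ℝ, y u = 1 ∧ (∀ v, v ≠ u → ∀ b, ρ v = some b → |y v| ≤ b) ∧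
      (∀ e, ∑ v, rowE e v * y v = rhs e) ∧ (∀ i, ∑ v, rowI i v * y v ≤ upper i) ∧
      (∀ k, (Cb k + ∑ v, y v • F k v).PosSemidef) ∧ val = ∑ v, c v * y v + c0}) :
    sInf {val : ℝ | ∃ y : V → ℝ, y u = 1 ∧ (∀ v, v ≠ u → ∀ b, ρ v = some b → |y v| ≤ b) ∧
      (∀ e, ∑ v, rowE e v * y v = rhs e) ∧ (∀ i, ∑ v, rowI i v * y v ≤ upper i) ∧
      (∀ k, (Cb k + ∑ v, y v • F k v).PosSemidef) ∧ val = ∑ v, c v * y v + c0} ≤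
      ∑ v, c v * yt v + c0 :=
  csInf_le hbdd ⟨yt, hyu, hρ, heq, hineq, hpsd, rfl⟩

/-- theorem (**two-sided enclosure with free variables**). If a lower certificate in the free-variable
layout (`lmiForm_bound_freeVars`: multipliers, blocks `Z_k − d_k·1 ⪰ 0`, exact residuals with `r_v = 0` on
the unbounded coordinates, trace bounds) and an exactly feasible point `ỹ` are both at hand for the SAME
program, then the program's optimal value `inf` is ENCLOSED:
`β − Σ_{v≠u} |r_v|·(ρ_v).getD 0 − Σ_k |min(0,d_k)| τ_k ≤ inf ≤ c·ỹ + c₀` (and the feasible value set is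
bounded below by the left-hand side, so the infimum is a real number). SOURCE:
[cite: JanssonChaykinKeil2008, Thm 3.2 and Thm 4.1 (two-sided rigorous bounds)] and
[cite: KeilJansson2006, Thm 1 and Thm 2 (ii)–(iii)] — a COROLLARY of `lmiForm_bound_freeVars` and
`lmiForm_sInf_le_of_feasible_freeVars`; DEVIATIONS / KINDS: as in those two (certsdp-conic/1 lower +
certsdp-primal/1 upper against one certsdp-problem/1 with null bounds allowed). NOT COVERED: as there. -/
theorem lmiForm_enclosure_freeVars (c : V → ℝ) (c0 : ℝ) (u : V)
    (rowE : E → V → ℝ) (rhs : E → ℝ) (rowI : I → V → ℝ) (upper : I → ℝ)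
    (Cb : ∀ k, Matrix (σ k) (σ k) ℝ) (F : ∀ k, V → Matrix (σ k) (σ k) ℝ)
    (ρ : V → Option ℝ) (τ : K → ℝ)
    -- trace bounds valid for every feasible point (problem-side hypothesis, as in lmiForm_bound)
    (hτ : ∀ y : V → ℝ, y u = 1 → (∀ v, v ≠ u → ∀ b, ρ v = some b → |y v| ≤ b) →
      (∀ e, ∑ v, rowE e v * y v = rhs e) → (∀ i, ∑ v, rowI i v * y v ≤ upper i) →
      (∀ k, (Cb k + ∑ v, y v • F k v).PosSemidef) → ∀ k, trace (Cb k + ∑ v, y v • F k v) ≤ τ k)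
    -- the lower certificate
    (lam : E → ℝ) (κ : I → ℝ) (hκ : ∀ i, 0 ≤ κ i) (Z : ∀ k, Matrix (σ k) (σ k) ℝ) (dZ : K → ℝ)
    (hZ : ∀ k, (Z k - dZ k • (1 : Matrix (σ k) (σ k) ℝ)).PosSemidef)
    (r : V → ℝ)
    (hr : ∀ v, r v = c v - ∑ e, lam e * rowE e v + ∑ i, κ i * rowI i v - ∑ k, trace (Z k * F k v))
    (hr0 : ∀ v, v ≠ u → ρ v = none → r v = 0)
    (β : ℝ)
    (hβ : β = c0 + r u + ∑ e, lam e * rhs e - ∑ i, κ i * upper i - ∑ k, trace (Z k * Cb k))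
    -- the exactly feasible point
    {yt : V → ℝ} (hyu : yt u = 1) (hρt : ∀ v, v ≠ u → ∀ b, ρ v = some b → |yt v| ≤ b)
    (heqt : ∀ e, ∑ v, rowE e v * yt v = rhs e) (hineqt : ∀ i, ∑ v, rowI i v * yt v ≤ upper i)
    (hpsdt : ∀ k, (Cb k + ∑ v, yt v • F k v).PosSemidef) :
    β - ∑ v ∈ Finset.univ.erase u, |r v| * (ρ v).getD 0 - ∑ k, |min 0 (dZ k)| * τ k ≤
      sInf {val : ℝ | ∃ y : V → ℝ, y u = 1 ∧ (∀ v, v ≠ u → ∀ b, ρ v = some b → |y v| ≤ b) ∧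
        (∀ e, ∑ v, rowE e v * y v = rhs e) ∧ (∀ i, ∑ v, rowI i v * y v ≤ upper i) ∧
        (∀ k, (Cb k + ∑ v, y v • F k v).PosSemidef) ∧ val = ∑ v, c v * y v + c0} ∧
    sInf {val : ℝ | ∃ y : V → ℝ, y u = 1 ∧ (∀ v, v ≠ u → ∀ b, ρ v = some b → |y v| ≤ b) ∧
        (∀ e, ∑ v, rowE e v * y v = rhs e) ∧ (∀ i, ∑ v, rowI i v * y v ≤ upper i) ∧
        (∀ k, (Cb k + ∑ v, y v • F k v).PosSemidef) ∧ val = ∑ v, c v * y v + c0} ≤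
      ∑ v, c v * yt v + c0 := by
  set S := {val : ℝ | ∃ y : V → ℝ, y u = 1 ∧ (∀ v, v ≠ u → ∀ b, ρ v = some b → |y v| ≤ b) ∧
        (∀ e, ∑ v, rowE e v * y v = rhs e) ∧ (∀ i, ∑ v, rowI i v * y v ≤ upper i) ∧
        (∀ k, (Cb k + ∑ v, y v • F k v).PosSemidef) ∧ val = ∑ v, c v * y v + c0} with hS
  -- every feasible value is bounded below by the certificate's number
  have hlow : ∀ val ∈ S, β - ∑ v ∈ Finset.univ.erase u, |r v| * (ρ v).getD 0 - ∑ k, |min 0 (dZ k)| * τ k ≤ val := by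
    rintro val ⟨y, hyu', hρ', heq', hineq', hpsd', rfl⟩
    exact lmiForm_bound_freeVars c c0 u rowE rhs rowI upper Cb F ρ τ hyu' hρ' heq' hineq' hpsd'
      (hτ y hyu' hρ' heq' hineq' hpsd') lam κ hκ Z dZ hZ r hr hr0 β hβ
  have hne : S.Nonempty := ⟨_, yt, hyu, hρt, heqt, hineqt, hpsdt, rfl⟩
  have hbdd : BddBelow S := ⟨_, hlow⟩
  refine ⟨le_csInf hne hlow, ?_⟩
  exact csInf_le hbdd ⟨yt, hyu, hρt, heqt, hineqt, hpsdt, rfl⟩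

end FreeVariablesUpper

end JanssonChaykinKeil

end Literature.Computation.Certificates
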